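import Summits.AtomisticToContinuum.HydrodynamicLimit.Theses.RelayRaceLocality
import Literature.Analysis.FluidPDE.HardSphereAlexander
import Literature.Analysis.FluidPDE.HardSpherePhaseSpaceProofs
import Literature.MathematicalPhysics.KineticTheory.HardSphereEulerProofs
import Literature.MathematicalPhysics.KineticTheory.HardSphereCanonicalTorus
import Literature.Barriers.AtomisticToContinuum.BoltzmannHypothesis

/-!
# Disproof of `GibbsLightCone` (stmt-AtomisticToContinuum-12501) — standing disprover, cycle 1

VERDICT (cycle 1): NO KILL. The crux — an equilibrium Lieb–Robinson-type cone for the APST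
backward clusters of `N+1` hard spheres at fixed reduced density `σ³` on `𝕋³` — elaborates
(rc 0), is NON-VACUOUS (the laws are probability measures, `isProbabilityMeasure_localGibbsLaw`
for `σ ≤ 1/2`; flows exist for `0 < ε < 1/2` by Alexander's theorem
`HardSphereFlow.nonempty_torus_holds`, PROVED in the tree — so every `¬`-statement below is
UNCONDITIONAL, no `--negative-modulo`), and resists every cheap attack listed here. Everything
conclusive is a theorem of this file (sorry-free); prose lives in docstrings only. Landed copies:
`Theorems/GibbsLightCone/Negative/{SignHypotheses,DegenerateRegimes,IdealGas}.lean` (proposed).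

## Findings (index)

* §0 READBACK. `gibbsLightCone_iff` (by `Iff.rfl`): the crux is
  `∀ a θ > 0 ∃ σ₀ > 0 ∃ c > 0 ∀ σ ∈ (0,σ₀) ∀ Φ ∀ t ≥ 0 ∀ δ > 0, G_N (E_N c t δ) → 0`, with
  `G_N = localGibbsLaw σ a 0 θ N (Φ N) = Z⁻¹ 1_{D_ε} ∏ᵢ a M_θ(vᵢ) d vol`, `ε = σ (N+1)^{-1/3}`, and
  `E_N = {z | ∃ i j, (j = i ∨ j ∈ BC_Φ(i,(0,t],z)) ∧ c t + δ < dist_𝕋³(x_j(0), x_i(t))}`.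
  No junk operator bites: `dist_𝕋³ ≤ √3/2` (`euclidDist_le_sqrt_three_half`), `BC = ∅` off the
  good set and over `(0,0]`, `Φ_0 = id` on the good set, the good set is Gibbs-conull
  (`gibbs_compl_good`). Quantifier order = informal text. The activity `a` cancels in `Z⁻¹`.
* §A LOAD-BEARING HYPOTHESES (dropped one at a time):
  - `0 ≤ t`: REFUTED without it — `gibbsLightCone_false_without_nonnegTime` (t = −2/c, δ = 1:
    threshold −1, event = `univ`, probability 1 for every N). Junk-sign kill only: for t < 0 the
    honest statement reads `c |t|`.
  - `0 < δ`: REFUTED without it — `gibbsLightCone_false_without_posDelta` (δ = −1, t = 0). But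
    `δ = 0` is harmless at `t = 0` (`gibbs_cruxEvent_zero` needs only `0 ≤ δ`) and plausibly at
    `t > 0`: "δ > 0 possibly unnecessary beyond δ ≥ 0" (information for the prover).
  - `0 < θ`: NOT load-bearing — for `θ ≤ 0` the Maxwellian is the `rpow` junk `0`, the law is the
    ZERO measure and the crux shape holds for every `c` (`gibbs_eq_zero_of_temp_nonpos`,
    `cruxShape_of_temp_nonpos`).
  - `0 < a`: NOT load-bearing — the law does not depend on `a ≠ 0` (`gibbs_activity`: `aⁿ` cancels
    against `Z⁻¹`, any sign) and is `0` at `a = 0` (`gibbs_activity_zero`), so the crux IMPLIES the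
    variant without `0 < a` (`gibbsLightConeWithoutPosActivity_of_crux`, §A5b): equivalent.
  - `0 < σ`: LOAD-BEARING (the only physics) — REFUTED without it, UNCONDITIONALLY
    (`gibbsLightCone_false_without_posDiameter`, §A6): at `σ = -1` the diameters are negative, the
    hard-sphere domain is everything, the contact sets are empty, free flight with good set `univ`
    IS a `HardSphereFlow` (`IdealGas.idealGasFlow`), velocities stay Maxwellian under the Gibbs
    law whatever the hard core (`IdealGas.gibbs_vel_apply`, one-particle marginal via
    `lintegral_localGibbsMeasure`), and with `t = 1/(8c)`, `δ = 1/8` the `j = i = 0` clause holds on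
    `{1/4 < ‖t v₀‖ < 1/2}`, of fixed positive Gaussian probability: no decay. Any proof uses
    collisions (`ℓ_N → 0`) already for the own-displacement clause.
  - `σ < σ₀`: NOT refutable by density — above close packing the domain is empty for large N and
    the law is 0 (vacuous truth); in the fluid/crystal window a cone is physically expected.
    Needed by the PROOF (dilute Palm/cluster bounds), not by truth.
  - the restriction `j ∈ BC(i)`: load-bearing trivially (t = 0, two far particles; informal).
* §B TIGHTNESS (numbers for the prover, not Lean facts). Velocity scaling forces
  `c(θ) = κ √θ`; the measured front speed at packing 0.1 is `v* ≈ 3.0 √θ` (ideator 2, EDMD,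
  N = 10³…8·10³, ±2 %, flat in N at equal times, kit j015350) and `2.1 v̄ = 3.35 √θ` (ideator 3,
  N = 4·10³…1.28·10⁵, no trend while ⟨v_max⟩/v̄ grew 2.81 → 3.22, kit j015306/309/387);
  `≈ 2.2 √θ` at packing 0.05. UNITS of `stub_taggedWindowSpanTail`: `ℓ_N = (N+1)^{-1/3}/σ² =
  √2 π mfp = 4.44 mfp`, `τ_N = ℓ_N/√θ = 7.09 mean free times`, and a speed `s √θ` is `λ = s`
  exactly; so a witness needs `λ > v*/√θ ≈ 3.0–3.4` (packing 0.1; ≈ 2.2 dilute), and the measured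
  one-particle tails `P(span ≥ 3M' mfp) ≈ 0.25·2^{-M'}`, `P(≥ 4M' mfp) ≈ e^{-1.5M'}` (M' in mean
  free times) read `(λ, c) ≈ (4.8, 4.9)` and `(6.4, 10.6)` per window, `C ≈ 0.25–1`
  (evidence `stubs/TaggedWindowSpanTail.md`). `θ`-uniform `c` is false (scaling).
* §C STRENGTHENINGS. d = 1 analogue FALSE (velocity exchange = ballistic pulses at the speed of
  the fastest particle `≍ √(2θ log N)`; ideator 2 §5: R/T = 2.51, 3.09, 3.25 at N = 2·10³, 2·10⁴,
  10⁵) — any proof uses d ≥ 2 energy SHARING. Focusing relays (route audit T9) do NOT kill: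
  best-of-`2^k` log-energy BRW has Biggins drift `inf_s log(2/(s+1))/s = −0.232 < 0` (s ≈ 3.3),
  the greedy lineage loses `E log max(U,1−U) = −0.307` nats/collision (`U ∼ U[½,1]` from
  `b² ∼ U[0,ε²]`), MD −0.234 ± 0.21 (n = 360); since `U ≤ 1` there is no Kesten power tail of
  lineage energies, the high-energy sector of the tilted first-moment operator is subcritical
  (weight `E^s`, `2/(s+1) · (1−λ̃)⁻¹ < 1`). For the C⁺ shape: `λ < 0` is impossible
  (`taggedTail_lam_nonneg`) and its content is `1 ≤ M < M*(N) = √3 σ² (N+1)^{1/3}/(2λ)`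
  (`taggedEvent_eq_empty`).
* §D LINE `Sketch`. Stubs windowComposition / clusterShift / gibbsInvariance / asymptotics /
  reduction are LANDED sorry-free (`Theorems/RelayRaceLocalityGibbsLightConeStub*.lean`): joint
  sufficiency is kernel-checked, nothing left to attack there. The one open stub
  C⁺ = `stub_taggedWindowSpanTail` is STRICTLY STRONGER than the crux (quantitative `C e^{-cM}`,
  all `M ≥ 1`, one tagged particle): refuting C⁺ would not refute the crux. Attacks on C⁺, all
  survived: large `M` (empty event); the covering window `M ∈ [0.29 σ²(N+1)^{1/3}, M*)` (cluster
  = all particles) is consistent iff `λ √θ > v*`; dense needles (k aligned spheres, gaps `ε/λ`)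
  reach `k σ³ ℓ_N` in `k σ³/λ` windows with probability `≍ (σ³ω/λ)^k` — exponential in M, no
  N factor for ONE tagged particle; own displacement at M = 1 costs `e^{-λ²/2} ≤ C e^{-c}`.
* §D2 LOG-WINDOW SHAPE C⁺_log (skeleton rev 3, the lead's `disprover-wanted`): NOT misstated — no
  cheap witness against the shape (quantifier order `∃ lam c C ∀ K` is implied by the all-M truth;
  the log window is kinetic-scale so no wrap-around; thresholds after `K, σ, Φ`; free signs
  self-exclude: `logTail_lam_nonneg`). See the §D2 docstring for the itemised check.
* §E NEAR-MISSES: none left (the ideal-gas variant of cycle-1 draft is now proved, §A6); the file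
  is sorry-free.

Standing disprover refuter-cdisprove-stmt-AtomisticToContinuum-12501-0, 2026-08-16.
-/

noncomputable section

namespace Summit.AtomisticToContinuum.HydrodynamicLimit.Cruxes.GibbsLightCone.Disproof

open MeasureTheory Filter Set
open scoped ENNReal Topology
open Literature.MathematicalPhysics.KineticTheory Literature.Analysis.FluidPDE
open Literature.Analysis.FunctionSpaces (Torus.proj Torus.proj_add Torus.continuous_proj
  Torus.measurable_proj)
open Summit.AtomisticToContinuum.HydrodynamicLimit.Theses.RelayRaceLocality (GibbsLightCone)

/-! ## §0 Readback of the crux -/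

/-- The flows the crux quantifies over: `N+1` spheres of diameter `hsDiameter σ N` on `𝕋³`. -/
abbrev Flow (σ : ℝ) (N : ℕ) : Type :=
  HardSphereFlow (Torus.geometry (Fin 3)) (hsDiameter σ N) (N + 1)

/-- The homogeneous Gibbs law of the crux (constant activity `a`, zero drift, temperature `θ`). -/
def gibbs (σ a θ : ℝ) (N : ℕ) (Φ : Flow σ N) : Measure (Config (N + 1) (Fin 3) T3) :=
  localGibbsLaw σ (fun _ => a) (fun _ => 0) (fun _ => θ) N Φ

/-- The crux event `E_N(c, t, δ)`: some particle `i` and some `j ∈ {i} ∪ BC(i, (0,t])` with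
`dist_𝕋³(x_j(0), x_i(t)) > c t + δ`. -/
def cruxEvent (σ : ℝ) (N : ℕ) (Φ : Flow σ N) (c t δ : ℝ) : Set (Config (N + 1) (Fin 3) T3) :=
  {z | ∃ i j : Fin (N + 1), (j = i ∨ j ∈ Φ.backwardCluster i 0 t z) ∧
    c * t + δ < Torus.euclidDist (z j).1 ((Φ.flow t z) i).1}

/-- READBACK: the crux, definitionally. -/
theorem gibbsLightCone_iff :
    GibbsLightCone ↔ ∀ a θ : ℝ, 0 < a → 0 < θ → ∃ σ₀ : ℝ, 0 < σ₀ ∧ ∃ c : ℝ, 0 < c ∧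
      ∀ σ : ℝ, 0 < σ → σ < σ₀ → ∀ Φ : (N : ℕ) → Flow σ N, ∀ t : ℝ, 0 ≤ t → ∀ δ : ℝ, 0 < δ →
        Tendsto (fun N => gibbs σ a θ N (Φ N) (cruxEvent σ N (Φ N) c t δ)) atTop (𝓝 0) :=
  Iff.rfl

/-! ## Infrastructure: flows exist, laws are probabilities, the good set is conull -/

/-- Alexander's theorem (PROVED in the tree) at the crux's diameters: flows exist for
`0 < σ < 1/2`. Hence no refutation here is "modulo flows". -/
theorem flow_nonempty {σ : ℝ} (hσ : 0 < σ) (hσ' : σ < 2⁻¹) (N : ℕ) : Nonempty (Flow σ N) :=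
  HardSphereFlow.nonempty_torus_holds (hsDiameter_pos hσ N)
    ((hsDiameter_le hσ.le N).trans_lt hσ') (N + 1)

/-- A chosen family of flows (any two agree Liouville-a.e.; the crux quantifies over all). -/
def someFlow {σ : ℝ} (hσ : 0 < σ) (hσ' : σ < 2⁻¹) (N : ℕ) : Flow σ N :=
  Classical.choice (flow_nonempty hσ hσ' N)

/-- The homogeneous Gibbs law is a probability measure for `σ ≤ 1/2` (tree theorem). -/
theorem isProbabilityMeasure_gibbs {σ a θ : ℝ} (ha : 0 < a) (hθ : 0 < θ) (hσ : σ ≤ 1 / 2)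
    (N : ℕ) (Φ : Flow σ N) : IsProbabilityMeasure (gibbs σ a θ N Φ) :=
  isProbabilityMeasure_localGibbsLaw continuous_const continuous_const continuous_const
    (fun _ => ha) (fun _ => hθ) hσ N Φ

/-- The Gibbs law does not charge the complement of the good set (`particleLaw ≪ liouville`). -/
theorem gibbs_compl_good (σ a θ : ℝ) (N : ℕ) (Φ : Flow σ N) : gibbs σ a θ N Φ Φ.goodᶜ = 0 := by
  rw [gibbs, localGibbsLaw, particleLaw_eq]
  exact withDensity_absolutelyContinuous _ _ Φ.measure_compl_good

/-- A small admissible reduced diameter below any `σ₀ > 0` and below `1/2`. -/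
theorem exists_sigma {σ₀ : ℝ} (hσ₀ : 0 < σ₀) : ∃ σ : ℝ, 0 < σ ∧ σ < σ₀ ∧ σ < 2⁻¹ :=
  ⟨min (σ₀ / 2) 4⁻¹, lt_min (by linarith) (by norm_num),
    (min_le_left _ _).trans_lt (by linarith), (min_le_right _ _).trans_lt (by norm_num)⟩

/-! ## §A1 Monotonicity: the event shrinks as `c`, `δ` grow (WLOG `c` large) -/

theorem cruxEvent_anti {σ : ℝ} {N : ℕ} (Φ : Flow σ N) {c c' t δ δ' : ℝ} (ht : 0 ≤ t)
    (hc : c ≤ c') (hδ : δ ≤ δ') : cruxEvent σ N Φ c' t δ' ⊆ cruxEvent σ N Φ c t δ := by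
  rintro z ⟨i, j, hij, hlt⟩
  exact ⟨i, j, hij, lt_of_le_of_lt (add_le_add (mul_le_mul_of_nonneg_right hc ht) hδ) hlt⟩

/-- A larger cone speed / overshoot inherits the conclusion. -/
theorem tendsto_of_le {σ a θ : ℝ} (Φ : (N : ℕ) → Flow σ N) {c c' t δ δ' : ℝ} (ht : 0 ≤ t)
    (hc : c ≤ c') (hδ : δ ≤ δ')
    (h : Tendsto (fun N => gibbs σ a θ N (Φ N) (cruxEvent σ N (Φ N) c t δ)) atTop (𝓝 0)) :
    Tendsto (fun N => gibbs σ a θ N (Φ N) (cruxEvent σ N (Φ N) c' t δ')) atTop (𝓝 0) :=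
  tendsto_of_tendsto_of_tendsto_of_le_of_le tendsto_const_nhds h (fun _ => zero_le)
    fun N => measure_mono (cruxEvent_anti (Φ N) ht hc hδ)

/-! ## §A2 The `t = 0` slice is null (for every `δ ≥ 0`, every `N`, every flow) -/

theorem cruxEvent_zero_subset {σ : ℝ} {N : ℕ} (Φ : Flow σ N) (c : ℝ) {δ : ℝ} (hδ : 0 ≤ δ) :
    cruxEvent σ N Φ c 0 δ ⊆ Φ.goodᶜ := by
  rintro z ⟨i, j, hij, hlt⟩ hz
  have hfl : Φ.flow 0 z = z := Φ.flow_zero z hz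
  rcases hij with rfl | hmem
  · rw [hfl, Torus.euclidDist_self, mul_zero, zero_add] at hlt
    exact absurd hlt (not_lt.2 hδ)
  · rw [HardSphereFlow.backwardCluster_apply Φ hz,
      Literature.MathematicalPhysics.KineticTheory.backwardCluster_of_le le_rfl] at hmem
    simp at hmem

/-- DEGENERATE CASE HOLDS: at `t = 0` the crux event is Gibbs-null, already for `δ ≥ 0`. -/
theorem gibbs_cruxEvent_zero (σ a θ : ℝ) (N : ℕ) (Φ : Flow σ N) (c : ℝ) {δ : ℝ} (hδ : 0 ≤ δ) :
    gibbs σ a θ N Φ (cruxEvent σ N Φ c 0 δ) = 0 :=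
  measure_mono_null (cruxEvent_zero_subset Φ c hδ) (gibbs_compl_good σ a θ N Φ)

/-! ## §A3 Large times are free: the event is EMPTY once `c t + δ ≥ √3/2` -/

/-- Minimal-image distances on the unit `3`-torus are at most `√3/2`. -/
theorem euclidDist_le_sqrt_three_half (x y : T3) : Torus.euclidDist x y ≤ Real.sqrt 3 / 2 := by
  have h := Torus.norm_reprSym_le_holds (x - y)
  simpa [Torus.euclidDist, Fintype.card_fin] using h

theorem cruxEvent_eq_empty {σ : ℝ} {N : ℕ} (Φ : Flow σ N) {c t δ : ℝ}
    (h : Real.sqrt 3 / 2 ≤ c * t + δ) : cruxEvent σ N Φ c t δ = ∅ := by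
  ext z
  simp only [cruxEvent, mem_setOf_eq, mem_empty_iff_false, iff_false, not_exists, not_and,
    not_lt]
  intro i j _
  exact (euclidDist_le_sqrt_three_half _ _).trans h

/-- The CONTENTFUL CORE of the crux: only `0 < t` with `c t + δ < √3/2` matters. -/
def GibbsLightConeCore : Prop :=
  ∀ a θ : ℝ, 0 < a → 0 < θ → ∃ σ₀ : ℝ, 0 < σ₀ ∧ ∃ c : ℝ, 0 < c ∧
    ∀ σ : ℝ, 0 < σ → σ < σ₀ → ∀ Φ : (N : ℕ) → Flow σ N, ∀ t : ℝ, 0 < t → ∀ δ : ℝ, 0 < δ →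
      c * t + δ < Real.sqrt 3 / 2 →
      Tendsto (fun N => gibbs σ a θ N (Φ N) (cruxEvent σ N (Φ N) c t δ)) atTop (𝓝 0)

/-- NORMAL FORM: the crux is equivalent to its core (t = 0 is null, large times are empty). -/
theorem gibbsLightCone_iff_core : GibbsLightCone ↔ GibbsLightConeCore := by
  rw [gibbsLightCone_iff]
  constructor
  · intro h a θ ha hθ
    obtain ⟨σ₀, hσ₀, c, hc, h⟩ := h a θ ha hθ
    exact ⟨σ₀, hσ₀, c, hc, fun σ hσ hσ' Φ t ht δ hδ _ => h σ hσ hσ' Φ t ht.le δ hδ⟩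
  · intro h a θ ha hθ
    obtain ⟨σ₀, hσ₀, c, hc, h⟩ := h a θ ha hθ
    refine ⟨σ₀, hσ₀, c, hc, fun σ hσ hσ' Φ t ht δ hδ => ?_⟩
    rcases ht.eq_or_lt with rfl | ht'
    · have h0 : (fun N => gibbs σ a θ N (Φ N) (cruxEvent σ N (Φ N) c 0 δ)) = fun _ => 0 :=
        funext fun N => gibbs_cruxEvent_zero σ a θ N (Φ N) c hδ.le
      rw [h0]
      exact tendsto_const_nhds
    · by_cases hbig : Real.sqrt 3 / 2 ≤ c * t + δ
      · have h0 : (fun N => gibbs σ a θ N (Φ N) (cruxEvent σ N (Φ N) c t δ)) = fun _ => 0 :=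
          funext fun N => by rw [cruxEvent_eq_empty (Φ N) hbig, measure_empty]
        rw [h0]
        exact tendsto_const_nhds
      · exact h σ hσ hσ' Φ t ht' δ hδ (not_le.1 hbig)

/-! ## §A4 Dropping `0 ≤ t` or `0 < δ` — refuted (junk-sign kills, unconditional) -/

/-- If the threshold `c t + δ` is negative the crux event is everything (`j = i`, `dist ≥ 0`). -/
theorem cruxEvent_eq_univ {σ : ℝ} {N : ℕ} (Φ : Flow σ N) {c t δ : ℝ} (h : c * t + δ < 0) :
    cruxEvent σ N Φ c t δ = univ :=
  eq_univ_of_forall fun _ => ⟨0, 0, Or.inl rfl, h.trans_le (norm_nonneg _)⟩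

/-- A sequence of probability-one events does not tend to `0` (laws are probabilities,
`σ ≤ 1/2`). -/
theorem not_tendsto_of_eq_univ {σ a θ : ℝ} (ha : 0 < a) (hθ : 0 < θ) (hσ : σ ≤ 1 / 2)
    (Φ : (N : ℕ) → Flow σ N) (E : (N : ℕ) → Set (Config (N + 1) (Fin 3) T3))
    (hE : ∀ N, E N = univ) : ¬ Tendsto (fun N => gibbs σ a θ N (Φ N) (E N)) atTop (𝓝 0) := by
  intro h
  have h1 : (fun N => gibbs σ a θ N (Φ N) (E N)) = fun _ => 1 := funext fun N => by
    haveI := isProbabilityMeasure_gibbs ha hθ hσ N (Φ N)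
    rw [hE N, measure_univ]
  rw [h1] at h
  exact one_ne_zero (tendsto_const_nhds_iff.1 h)

/-- The crux with the hypothesis `0 ≤ t` DELETED (all else verbatim). -/
def GibbsLightConeWithoutNonnegTime : Prop :=
  ∀ a θ : ℝ, 0 < a → 0 < θ → ∃ σ₀ : ℝ, 0 < σ₀ ∧ ∃ c : ℝ, 0 < c ∧
    ∀ σ : ℝ, 0 < σ → σ < σ₀ → ∀ Φ : (N : ℕ) → Flow σ N, ∀ t : ℝ, ∀ δ : ℝ, 0 < δ →
      Tendsto (fun N => gibbs σ a θ N (Φ N) (cruxEvent σ N (Φ N) c t δ)) atTop (𝓝 0)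

/-- Sanity: the variant implies the crux (contrapositive form). -/
theorem GibbsLightConeWithoutNonnegTime.not_of_not_crux :
    ¬ GibbsLightCone → ¬ GibbsLightConeWithoutNonnegTime := fun h hw =>
  h (gibbsLightCone_iff.2 fun a θ ha hθ => by
    obtain ⟨σ₀, hσ₀, c, hc, h'⟩ := hw a θ ha hθ
    exact ⟨σ₀, hσ₀, c, hc, fun σ hσ hσ' Φ t _ δ hδ => h' σ hσ hσ' Φ t δ hδ⟩)

/-- ANY PROOF MUST USE `0 ≤ t` — but only through the sign of the threshold: at `t = -2/c`,
`δ = 1` the threshold is `-1`, the event is everything and its probability is `1` for every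
`N`. (For negative times the honest statement has `c |t|`.) Unconditional: flows from
Alexander's theorem, probabilities from `isProbabilityMeasure_localGibbsLaw`. -/
theorem gibbsLightCone_false_without_nonnegTime : ¬ GibbsLightConeWithoutNonnegTime := by
  intro h
  obtain ⟨σ₀, hσ₀, c, hc, h⟩ := h 1 1 one_pos one_pos
  obtain ⟨σ, hσ, hσlt, hσhalf⟩ := exists_sigma hσ₀
  have hc2 : c * (2 / c) = 2 := by field_simp
  refine not_tendsto_of_eq_univ one_pos one_pos (by linarith) (fun N => someFlow hσ hσhalf N) _
    (fun N => cruxEvent_eq_univ _ ?_) (h σ hσ hσlt _ (-(2 / c)) 1 one_pos)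
  rw [mul_neg, hc2]
  norm_num

/-- The crux with the hypothesis `0 < δ` DELETED (δ ranges over `ℝ`; all else verbatim). -/
def GibbsLightConeWithoutPosDelta : Prop :=
  ∀ a θ : ℝ, 0 < a → 0 < θ → ∃ σ₀ : ℝ, 0 < σ₀ ∧ ∃ c : ℝ, 0 < c ∧
    ∀ σ : ℝ, 0 < σ → σ < σ₀ → ∀ Φ : (N : ℕ) → Flow σ N, ∀ t : ℝ, 0 ≤ t → ∀ δ : ℝ,
      Tendsto (fun N => gibbs σ a θ N (Φ N) (cruxEvent σ N (Φ N) c t δ)) atTop (𝓝 0)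

/-- Sanity: the variant implies the crux (contrapositive form). -/
theorem GibbsLightConeWithoutPosDelta.not_of_not_crux :
    ¬ GibbsLightCone → ¬ GibbsLightConeWithoutPosDelta := fun h hw =>
  h (gibbsLightCone_iff.2 fun a θ ha hθ => by
    obtain ⟨σ₀, hσ₀, c, hc, h'⟩ := hw a θ ha hθ
    exact ⟨σ₀, hσ₀, c, hc, fun σ hσ hσ' Φ t ht δ _ => h' σ hσ hσ' Φ t ht δ⟩)

/-- ANY PROOF MUST USE `0 < δ` — again only through the sign of the threshold (`δ = -1`,
`t = 0`). NOTE the complement: `δ = 0` is harmless at `t = 0` (`gibbs_cruxEvent_zero`), and for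
`t > 0` the overshoot `δ` is plausibly unnecessary (`c t ≫ ℓ_N` eventually): the honest
load-bearing content is `0 ≤ δ`. -/
theorem gibbsLightCone_false_without_posDelta : ¬ GibbsLightConeWithoutPosDelta := by
  intro h
  obtain ⟨σ₀, hσ₀, c, hc, h⟩ := h 1 1 one_pos one_pos
  obtain ⟨σ, hσ, hσlt, hσhalf⟩ := exists_sigma hσ₀
  refine not_tendsto_of_eq_univ one_pos one_pos (by linarith) (fun N => someFlow hσ hσhalf N) _
    (fun N => cruxEvent_eq_univ _ ?_) (h σ hσ hσlt _ 0 le_rfl (-1))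
  norm_num

/-! ## §A5 `0 < θ` is NOT load-bearing: for `θ ≤ 0` the law is the zero measure -/

/-- The `rpow` junk: for `θ ≤ 0` the local Maxwellian on `ℝ³` vanishes identically
(`(2πθ)^(-3/2) = 0` for a negative base since `cos(-3π/2) = 0`, and `0^(-3/2) = 0`). -/
theorem localMaxwellian_eq_zero_of_nonpos {θ : ℝ} (hθ : θ ≤ 0) (ρ : ℝ) (u v : V3) :
    localMaxwellian ρ θ u v = 0 := by
  unfold localMaxwellian
  have hfin : (Module.finrank ℝ V3 : ℝ) = 3 := by
    rw [finrank_euclideanSpace_fin]; norm_num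
  have hexp : (-(Module.finrank ℝ V3 : ℝ) / 2 : ℝ) = -(3 / 2) := by rw [hfin]; norm_num
  rw [hexp]
  have hbase : (2 * Real.pi * θ) ^ (-(3 / 2 : ℝ)) = 0 := by
    rcases hθ.eq_or_lt with rfl | hlt
    · rw [mul_zero, Real.zero_rpow (by norm_num)]
    · have hneg : 2 * Real.pi * θ < 0 := mul_neg_of_pos_of_neg (by positivity) hlt
      rw [Real.rpow_def_of_neg hneg]
      have hcos : Real.cos (-(3 / 2 : ℝ) * Real.pi) = 0 := by
        rw [show -(3 / 2 : ℝ) * Real.pi = -(Real.pi / 2 + Real.pi) by ring, Real.cos_neg,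
          Real.cos_add_pi, Real.cos_pi_div_two, neg_zero]
      rw [hcos, mul_zero]
  rw [hbase, mul_zero, zero_mul]

/-- For `θ ≤ 0` the homogeneous Gibbs law is the ZERO measure (every `N ≥ 0`, every flow). -/
theorem gibbs_eq_zero_of_temp_nonpos {θ : ℝ} (hθ : θ ≤ 0) (σ a : ℝ) (N : ℕ) (Φ : Flow σ N) :
    gibbs σ a θ N Φ = 0 := by
  have hprof : localGibbsProfile (fun _ => a) (fun _ => (0 : V3)) (fun _ => θ) = 0 := by
    funext y
    simp [localGibbsProfile, localMaxwellian_eq_zero_of_nonpos hθ]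
  have hdens : ∀ z, canonicalDensity (Torus.geometry (Fin 3)) (hsDiameter σ N) (N + 1)
      (localGibbsProfile (fun _ => a) (fun _ => (0 : V3)) (fun _ => θ)) z = 0 := by
    intro z
    rw [hprof, canonicalDensity]
    have htp : tensorPow (N + 1) (0 : T3 × V3 → ℝ) z = 0 := by
      simp [tensorPow]
    by_cases hz : z ∈ hardSphereDomain (Torus.geometry (Fin 3)) (N + 1) (hsDiameter σ N)
    · rw [indicator_of_mem hz, htp, mul_zero]
    · rw [indicator_of_notMem hz, mul_zero]
  rw [gibbs, localGibbsLaw, particleLaw_eq]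
  have : (fun z => ENNReal.ofReal (canonicalDensity (Torus.geometry (Fin 3)) (hsDiameter σ N)
      (N + 1) (localGibbsProfile (fun _ => a) (fun _ => (0 : V3)) (fun _ => θ)) z)) = 0 := by
    funext z
    rw [hdens z, ENNReal.ofReal_zero, Pi.zero_apply]
  rw [this, withDensity_zero]

/-- Hence the crux SHAPE holds for `θ ≤ 0` with ANY `c` (vacuous truth by junk): the hypothesis
`0 < θ` carries no mathematical load. -/
theorem cruxShape_of_temp_nonpos {θ : ℝ} (hθ : θ ≤ 0) (σ a c t δ : ℝ) (Φ : (N : ℕ) → Flow σ N) :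
    Tendsto (fun N => gibbs σ a θ N (Φ N) (cruxEvent σ N (Φ N) c t δ)) atTop (𝓝 0) := by
  have : (fun N => gibbs σ a θ N (Φ N) (cruxEvent σ N (Φ N) c t δ)) = fun _ => 0 :=
    funext fun N => by rw [gibbs_eq_zero_of_temp_nonpos hθ]; rfl
  rw [this]
  exact tendsto_const_nhds

/-! ## §A5b `0 < a` is NOT load-bearing either: the law does not see the activity -/

section Activity

variable {d : Type*} {X : Type*}

/-- Tensor powers scale: `(a f)^{⊗n} = aⁿ f^{⊗n}`. -/
theorem tensorPow_const_mul (n : ℕ) (a : ℝ) (f : X × EuclideanSpace ℝ d → ℝ)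
    (z : Config n d X) : tensorPow n (fun y => a * f y) z = a ^ n * tensorPow n f z := by
  simp [tensorPow, Finset.prod_mul_distrib, Finset.prod_const, Finset.card_univ, Fintype.card_fin]

variable [Fintype d] [MeasureSpace X]

/-- Partition functions scale: `Z(a f) = aⁿ Z(f)` (unconditionally, Bochner conventions). -/
theorem canonicalPartition_const_mul (G : Geometry d X) (ε : ℝ) (n : ℕ) (a : ℝ)
    (f : X × EuclideanSpace ℝ d → ℝ) :
    canonicalPartition G ε n (fun y => a * f y) = a ^ n * canonicalPartition G ε n f := by
  unfold canonicalPartition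
  rw [← integral_const_mul]
  congr 1
  funext z
  by_cases hz : z ∈ hardSphereDomain G n ε
  · rw [indicator_of_mem hz, indicator_of_mem hz, tensorPow_const_mul]
  · rw [indicator_of_notMem hz, indicator_of_notMem hz, mul_zero]

/-- **The canonical density does not see a nonzero scalar in the profile** (`aⁿ` cancels
against `Z⁻¹`, whatever the sign of `a`, also when `Z = 0`). -/
theorem canonicalDensity_const_mul (G : Geometry d X) (ε : ℝ) (n : ℕ) {a : ℝ} (ha : a ≠ 0)
    (f : X × EuclideanSpace ℝ d → ℝ) :
    canonicalDensity G ε n (fun y => a * f y) = canonicalDensity G ε n f := by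
  funext z
  unfold canonicalDensity
  rw [canonicalPartition_const_mul]
  by_cases hz : z ∈ hardSphereDomain G n ε
  · rw [indicator_of_mem hz, indicator_of_mem hz, tensorPow_const_mul, mul_inv, mul_mul_mul_comm,
      inv_mul_cancel₀ (pow_ne_zero n ha), one_mul]
  · rw [indicator_of_notMem hz, indicator_of_notMem hz, mul_zero, mul_zero]

end Activity

/-- Constant activity factors out of the local Gibbs profile. -/
theorem localGibbsProfile_const_activity (a : ℝ) (u : T3 → V3) (θ : T3 → ℝ) :
    localGibbsProfile (fun _ => a) u θ = fun y => a * localGibbsProfile (fun _ => 1) u θ y := by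
  funext y
  simp [localGibbsProfile]

/-- **The homogeneous Gibbs law does not depend on the activity `a ≠ 0`** (any sign). -/
theorem gibbs_activity {σ a : ℝ} (ha : a ≠ 0) (θ : ℝ) (N : ℕ) (Φ : Flow σ N) :
    gibbs σ a θ N Φ = gibbs σ 1 θ N Φ := by
  rw [gibbs, gibbs, localGibbsLaw, localGibbsLaw, localGibbsProfile_const_activity a,
    canonicalDensity_const_mul _ _ _ ha]

/-- At zero activity the law is the zero measure. -/
theorem gibbs_activity_zero (σ θ : ℝ) (N : ℕ) (Φ : Flow σ N) : gibbs σ 0 θ N Φ = 0 := by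
  have hprof : localGibbsProfile (fun _ => (0 : ℝ)) (fun _ => (0 : V3)) (fun _ => θ) = 0 := by
    funext y
    simp [localGibbsProfile]
  rw [gibbs, localGibbsLaw, particleLaw_eq, hprof]
  have h0 : (fun z => ENNReal.ofReal (canonicalDensity (Torus.geometry (Fin 3)) (hsDiameter σ N)
      (N + 1) (0 : T3 × V3 → ℝ) z)) = 0 := by
    funext z
    rw [Pi.zero_apply, canonicalDensity]
    have htp : tensorPow (N + 1) (0 : T3 × V3 → ℝ) z = 0 := by simp [tensorPow]
    by_cases hz : z ∈ hardSphereDomain (Torus.geometry (Fin 3)) (N + 1) (hsDiameter σ N)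
    · rw [indicator_of_mem hz, htp, mul_zero, ENNReal.ofReal_zero]
    · rw [indicator_of_notMem hz, mul_zero, ENNReal.ofReal_zero]
  rw [h0, withDensity_zero]

/-- The crux with the hypothesis `0 < a` DELETED (`a` ranges over `ℝ`; all else verbatim). -/
def GibbsLightConeWithoutPosActivity : Prop :=
  ∀ a θ : ℝ, 0 < θ → ∃ σ₀ : ℝ, 0 < σ₀ ∧ ∃ c : ℝ, 0 < c ∧
    ∀ σ : ℝ, 0 < σ → σ < σ₀ → ∀ Φ : (N : ℕ) → Flow σ N, ∀ t : ℝ, 0 ≤ t → ∀ δ : ℝ, 0 < δ →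
      Tendsto (fun N => gibbs σ a θ N (Φ N) (cruxEvent σ N (Φ N) c t δ)) atTop (𝓝 0)

/-- **Dropping `0 < a` adds NOTHING**: the crux implies the variant without it (for `a ≠ 0` the
law is the law at `a = 1`, for `a = 0` it is the zero measure). Together with the trivial
converse the two statements are equivalent: `0 < a` is a typing hypothesis only. -/
theorem gibbsLightConeWithoutPosActivity_of_crux : GibbsLightCone → GibbsLightConeWithoutPosActivity := by
  rw [gibbsLightCone_iff]
  intro h a θ hθ
  obtain ⟨σ₀, hσ₀, c, hc, h1⟩ := h 1 θ one_pos hθ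
  refine ⟨σ₀, hσ₀, c, hc, fun σ hσ hσ' Φ t ht δ hδ => ?_⟩
  rcases eq_or_ne a 0 with rfl | ha
  · have h0 : (fun N => gibbs σ 0 θ N (Φ N) (cruxEvent σ N (Φ N) c t δ)) = fun _ => 0 :=
      funext fun N => by rw [gibbs_activity_zero]; rfl
    rw [h0]
    exact tendsto_const_nhds
  · have h0 : (fun N => gibbs σ a θ N (Φ N) (cruxEvent σ N (Φ N) c t δ)) =
        fun N => gibbs σ 1 θ N (Φ N) (cruxEvent σ N (Φ N) c t δ) :=
      funext fun N => by rw [gibbs_activity ha]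
    rw [h0]
    exact h1 σ hσ hσ' Φ t ht δ hδ

/-! ## §C/§D The C⁺ shape (`stub_taggedWindowSpanTail` of line `Sketch`) -/

/-- The C⁺ event of the tagged particle `p` over the window `(0, M τ]` with threshold
`λ M ℓ` (the stub has `ℓ = (N+1)^{-1/3}/σ²`, `τ = ℓ/√θ`; kept abstract here). -/
def taggedEvent (σ : ℝ) (N : ℕ) (Φ : Flow σ N) (p : Fin (N + 1)) (lam M ℓ τ : ℝ) :
    Set (Config (N + 1) (Fin 3) T3) :=
  {z | ∃ r : Fin (N + 1), (r = p ∨ r ∈ Φ.backwardCluster p 0 (M * τ) z) ∧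
    lam * M * ℓ < Torus.euclidDist (z r).1 ((Φ.flow (M * τ) z) p).1}

/-- C⁺ IS EMPTY FOR LARGE WINDOWS: once `λ M ℓ ≥ √3/2` the tagged event is empty, so the
content of C⁺ is `1 ≤ M < M*(N) := √3 σ² (N+1)^{1/3} / (2λ)` — still `≍ N^{1/3}` windows, far
beyond the `M ≍ log N` the reduction consumes. -/
theorem taggedEvent_eq_empty {σ : ℝ} {N : ℕ} (Φ : Flow σ N) (p : Fin (N + 1))
    {lam M ℓ τ : ℝ} (h : Real.sqrt 3 / 2 ≤ lam * M * ℓ) : taggedEvent σ N Φ p lam M ℓ τ = ∅ := by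
  ext z
  simp only [taggedEvent, mem_setOf_eq, mem_empty_iff_false, iff_false, not_exists, not_and,
    not_lt]
  intro r _
  exact (euclidDist_le_sqrt_three_half _ _).trans h

/-- If `λ M ℓ < 0` the tagged event is everything. -/
theorem taggedEvent_eq_univ {σ : ℝ} {N : ℕ} (Φ : Flow σ N) (p : Fin (N + 1))
    {lam M ℓ τ : ℝ} (h : lam * M * ℓ < 0) : taggedEvent σ N Φ p lam M ℓ τ = univ :=
  eq_univ_of_forall fun _ => ⟨p, Or.inl rfl, h.trans_le (norm_nonneg _)⟩

/-- NO C⁺ WITNESS HAS `λ < 0`: an exponential-in-`M` bound on the tagged event for all `M ≥ 1`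
forces `0 ≤ λ` as soon as the law is a probability measure (`σ ≤ 1/2`, `ℓ > 0`), because for
`λ < 0` the event is everything. (Sanity for `stub_taggedWindowSpanTail`, whose `lam` is
unconstrained; the reduction itself is indifferent to the sign.) -/
theorem taggedTail_lam_nonneg {σ a θ lam c C ℓ τ : ℝ} (ha : 0 < a) (hθ : 0 < θ)
    (hσ : σ ≤ 1 / 2) (hc : 0 < c) (hℓ : 0 < ℓ) {N : ℕ} (Φ : Flow σ N) (p : Fin (N + 1))
    (h : ∀ M : ℝ, 1 ≤ M →
      gibbs σ a θ N Φ (taggedEvent σ N Φ p lam M ℓ τ) ≤ ENNReal.ofReal (C * Real.exp (-c * M))) :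
    0 ≤ lam := by
  by_contra hlam
  push Not at hlam
  haveI := isProbabilityMeasure_gibbs ha hθ hσ N Φ
  -- the bound tends to 0, so some `M ≥ 1` has bound `< 1`
  have ht : Tendsto (fun M : ℝ => C * Real.exp (-c * M)) atTop (𝓝 0) := by
    have h1 : Tendsto (fun M : ℝ => Real.exp (-(c * M))) atTop (𝓝 0) :=
      Real.tendsto_exp_neg_atTop_nhds_zero.comp (tendsto_id.const_mul_atTop hc)
    have h2 := h1.const_mul C
    simp only [mul_zero] at h2
    refine h2.congr fun M => ?_
    rw [neg_mul]
  obtain ⟨M, hM1, hMlt⟩ := ((eventually_ge_atTop (1 : ℝ)).and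
    (ht.eventually (gt_mem_nhds zero_lt_one))).exists
  have hM : 0 < M := by linarith
  have hneg : lam * M * ℓ < 0 := mul_neg_of_neg_of_pos (mul_neg_of_neg_of_pos hlam hM) hℓ
  have key := h M hM1
  rw [taggedEvent_eq_univ Φ p hneg, measure_univ] at key
  exact absurd key (not_le.2 (ENNReal.ofReal_lt_one.2 hMlt))

/-! ## §D2 The LOG-WINDOW shape C⁺_log (`stub_taggedLogWindowSpanTail`, skeleton rev 3)

Answer to the lead's `disprover-wanted` (Lines/Sketch.md §4): is the log-window tail MISSTATED formally?
NO cheap witness exists; the shape is consistent: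
* quantifier order `∃ lam c C, ∀ K` — implied by the all-`M` truth (large deviations of the front give
  ONE rate `I(λ) > 0` for every `M`, so constants need not depend on `K`); the `N`-threshold may
  depend on `K, σ, Φ` and does (it sits after them) — fine;
* wrap-around near `M = K log(N+2)`: the threshold `λ K log(N+2) ℓ_N → 0` and the window
  `K log(N+2) τ_N → 0` — the whole log window is kinetic-scale, no torus effect at all (unlike C⁺
  strong, cf. `taggedEvent_eq_empty`);
* the `1 ≤ M` floor only fixes `C ≳ P(M = 1 event) e^{c}`; `log(N+2) > 0` keeps the range sane;
* flows enter only through null sets (forward uniqueness on `𝕋³`), `p` is exchangeable, `a` cancels,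
  kinetic units absorb `θ`; `σ`-uniform constants are continuous in the packing `πσ³/6 → 0`;
* free signs: `C ≤ 0` or `lam < 0` admit no witness (`logTail_lam_nonneg` below: with `K = 1`,
  `M = log(N+2)` the bound `C (N+2)^{-c} → 0` meets probability `1`); `lam = 0` is excluded as soon
  as particles move (not formalised). So a witness has `lam > 0 < C`, as intended, and the
  reduction is indifferent anyway. -/

/-- **C⁺_log sanity**: an exponential bound on the tagged one-window event over the log window
`1 ≤ M ≤ K log(N+2)`, for every `K > 0` and eventually in `N`, under the homogeneous Gibbs law
(`a, θ > 0`, `σ ≤ 1/2`) with positive length scales forces `0 ≤ lam`: for `lam < 0` the event is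
everything, and at `K = 1`, `M = log(N+2)` the bound is `C (N+2)^{-c} → 0`. -/
theorem logTail_lam_nonneg {σ a θ lam c C : ℝ} (ha : 0 < a) (hθ : 0 < θ) (hσ : σ ≤ 1 / 2)
    (hc : 0 < c) (Φ : (N : ℕ) → Flow σ N) (ℓ τ : ℕ → ℝ) (hℓ : ∀ N, 0 < ℓ N)
    (h : ∀ K : ℝ, 0 < K → ∀ᶠ N in atTop, ∀ p : Fin (N + 1), ∀ M : ℝ, 1 ≤ M →
      M ≤ K * Real.log ((N : ℝ) + 2) →
      gibbs σ a θ N (Φ N) (taggedEvent σ N (Φ N) p lam M (ℓ N) (τ N)) ≤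
        ENNReal.ofReal (C * Real.exp (-c * M))) :
    0 ≤ lam := by
  by_contra hlam
  push Not at hlam
  have hlog : Tendsto (fun N : ℕ => Real.log ((N : ℝ) + 2)) atTop atTop :=
    Real.tendsto_log_atTop.comp (tendsto_atTop_add_const_right _ _ tendsto_natCast_atTop_atTop)
  have hlim : Tendsto (fun N : ℕ => C * Real.exp (-c * Real.log ((N : ℝ) + 2))) atTop (𝓝 0) := by
    have h2 : Tendsto (fun N : ℕ => Real.exp (-(c * Real.log ((N : ℝ) + 2)))) atTop (𝓝 0) :=
      Real.tendsto_exp_neg_atTop_nhds_zero.comp (hlog.const_mul_atTop hc)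
    have h3 := h2.const_mul C
    simp only [mul_zero] at h3
    refine h3.congr fun N => ?_
    rw [neg_mul]
  obtain ⟨N, ⟨hN, hNlt⟩, hN1⟩ := (((h 1 one_pos).and (hlim.eventually (gt_mem_nhds zero_lt_one))).and
    (hlog.eventually (eventually_ge_atTop 1))).exists
  haveI := isProbabilityMeasure_gibbs ha hθ hσ N (Φ N)
  have hMpos : 0 < Real.log ((N : ℝ) + 2) := by linarith
  have hneg : lam * Real.log ((N : ℝ) + 2) * ℓ N < 0 :=
    mul_neg_of_neg_of_pos (mul_neg_of_neg_of_pos hlam hMpos) (hℓ N)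
  have key := hN 0 (Real.log ((N : ℝ) + 2)) hN1 (by rw [one_mul])
  rw [taggedEvent_eq_univ (Φ N) 0 hneg, measure_univ] at key
  exact absurd key (not_le.2 (ENNReal.ofReal_lt_one.2 hNlt))

/-! ## §A6 `0 < σ` IS load-bearing: the ideal gas has no light cone (unconditional)

Landed copy: `Theorems/GibbsLightCone/Negative/IdealGas.lean` (verbatim event; here over the
abbreviations `gibbs` / `cruxEvent`). -/

/-- The crux with the hypothesis `0 < σ` DELETED (so `σ = -1` — diameters `hsDiameter (-1) N < 0`,
no exclusion, no collisions: the IDEAL GAS — must be covered). -/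
def GibbsLightConeWithoutPosDiameter : Prop :=
  ∀ a θ : ℝ, 0 < a → 0 < θ → ∃ σ₀ : ℝ, 0 < σ₀ ∧ ∃ c : ℝ, 0 < c ∧
    ∀ σ : ℝ, σ < σ₀ → ∀ Φ : (N : ℕ) → Flow σ N, ∀ t : ℝ, 0 ≤ t → ∀ δ : ℝ, 0 < δ →
      Tendsto (fun N => gibbs σ a θ N (Φ N) (cruxEvent σ N (Φ N) c t δ)) atTop (𝓝 0)

/-- Sanity: the variant implies the crux (contrapositive form). -/
theorem GibbsLightConeWithoutPosDiameter.not_of_not_crux :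
    ¬ GibbsLightCone → ¬ GibbsLightConeWithoutPosDiameter := fun h hw =>
  h (gibbsLightCone_iff.2 fun a θ ha hθ => by
    obtain ⟨σ₀, hσ₀, c, hc, h'⟩ := hw a θ ha hθ
    exact ⟨σ₀, hσ₀, c, hc, fun σ _ hσ' Φ t ht δ hδ => h' σ hσ' Φ t ht δ hδ⟩)

namespace IdealGas

/-- For a nonpositive diameter the hard-sphere domain is all of phase space. -/
theorem hardSphereDomain_eq_univ {ε : ℝ} (hε : ε ≤ 0) (N : ℕ) :
    hardSphereDomain (Torus.geometry (Fin 3)) N ε = univ :=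
  eq_univ_of_forall fun _ _ _ _ => hε.trans (norm_nonneg _)

/-- For a negative diameter the contact sets are empty. -/
theorem contactSet_eq_empty {ε : ℝ} (hε : ε < 0) (N : ℕ) (i j : Fin N) :
    contactSet (Torus.geometry (Fin 3)) N ε i j = ∅ :=
  eq_empty_of_forall_notMem fun _ hz => (hε.trans_le (norm_nonneg _)).ne' (mem_contactSet.1 hz).2

/-- For a negative diameter no curve has a collision time. -/
theorem collisionTimes_eq_empty {ε : ℝ} (hε : ε < 0) {N : ℕ} (γ : ℝ → Config N (Fin 3) T3) :
    collisionTimes (Torus.geometry (Fin 3)) ε γ = ∅ := by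
  ext t
  simp [mem_collisionTimes, contactSet_eq_empty hε]

/-- Free flight on the torus phase space is measurable. -/
theorem measurable_freeFlight_torus (N : ℕ) (t : ℝ) :
    Measurable (freeFlight (N := N) (Torus.geometry (Fin 3)) t) := by
  refine measurable_pi_lambda _ fun i => ?_
  refine Measurable.prodMk ?_ (measurable_pi_apply i).snd
  show Measurable fun z : Config N (Fin 3) T3 => (z i).1 + Torus.proj (t • (z i).2)
  exact (measurable_pi_apply i).fst.add
    (Torus.measurable_proj.comp ((measurable_pi_apply i).snd.const_smul t))

/-- For a negative diameter every free-flight orbit is a hard-sphere trajectory. -/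
theorem isHardSphereTrajectory_freeFlight {ε : ℝ} (hε : ε < 0) {N : ℕ} (z : Config N (Fin 3) T3) :
    IsHardSphereTrajectory (Torus.geometry (Fin 3)) ε N
      fun t => freeFlight (Torus.geometry (Fin 3)) t z where
  mem t := by
    rw [hardSphereDomain_eq_univ hε.le]
    exact mem_univ _
  locFinite a b := by
    rw [collisionTimes_eq_empty hε, empty_inter]
    exact finite_empty
  pos_continuous i := by
    show Continuous fun t : ℝ => (z i).1 + Torus.proj (t • (z i).2)
    exact continuous_const.add (Torus.continuous_proj.comp (continuous_id.smul continuous_const))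
  free s t _ _ := by
    show freeFlight (Torus.geometry (Fin 3)) t z =
      freeFlight (Torus.geometry (Fin 3)) (t - s) (freeFlight (Torus.geometry (Fin 3)) s z)
    rw [← freeFlight_add, sub_add_cancel]
  binary t i j _ hc := by
    rw [contactSet_eq_empty hε] at hc
    exact absurd hc (notMem_empty _)

/-- THE IDEAL-GAS FLOW: for a negative diameter, free flight with good set `univ` is a
`HardSphereFlow` (Liouville = Lebesgue, preserved: `measurePreserving_freeFlight_torus_holds`). -/
def idealGasFlow {ε : ℝ} (hε : ε < 0) (N : ℕ) : HardSphereFlow (Torus.geometry (Fin 3)) ε N where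
  flow t z := freeFlight (Torus.geometry (Fin 3)) t z
  good := univ
  measurableSet_good := MeasurableSet.univ
  good_subset := fun z _ => by
    rw [hardSphereDomain_eq_univ hε.le]
    exact mem_univ z
  measure_compl_good := by rw [compl_univ, measure_empty]
  mapsTo_good _ := mapsTo_univ _ _
  flow_zero z _ := freeFlight_zero _ z
  flow_add s t z _ := freeFlight_add _ s t z
  measurable_flow t := measurable_freeFlight_torus N t
  isTrajectory z _ := isHardSphereTrajectory_freeFlight hε z
  measurePreserving t := by
    rw [liouville_eq, hardSphereDomain_eq_univ hε.le, Measure.restrict_univ]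
    exact Literature.Barriers.AtomisticToContinuum.measurePreserving_freeFlight_torus_holds
      (d := Fin 3) (N := N) t

/-- The diameters at `σ = -1` are negative. -/
theorem hsDiameter_neg_one_neg (N : ℕ) : hsDiameter (-1) N < 0 :=
  mul_neg_of_neg_of_pos (by norm_num) (Real.rpow_pos_of_pos (by positivity) _)

/-- A torus point displaced by `q` with `‖q‖ < 1/2` is at minimal-image distance exactly `‖q‖`. -/
theorem euclidDist_self_add_proj (x : T3) {q : V3} (hq : ‖q‖ < 1 / 2) :
    Torus.euclidDist x (x + Torus.proj q) = ‖q‖ := by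
  have hx : Torus.proj (Torus.reprSym x) = x := Torus.proj_reprSym x
  have hpq : ‖Torus.reprSym x - (Torus.reprSym x + q)‖ < 1 / 2 := by
    rwa [sub_add_cancel_left, norm_neg]
  conv_lhs => rw [← hx, ← Torus.proj_add]
  rw [euclidDist_proj_proj_of_norm_lt hpq, sub_add_cancel_left, norm_neg]

/-- ONE-PARTICLE VELOCITY MARGINAL of the homogeneous Gibbs law (`a, θ > 0`, any `σ ≤ 1/2`):
`G_N {z | v_i ∈ S} = N(0, θ id)(S)` — velocities are Maxwellian whatever the hard core
(disintegration `lintegral_localGibbsMeasure` applied to `𝟙_{v_i ∈ S}` and to `1`). -/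
theorem gibbs_vel_apply {σ a θ : ℝ} (ha : 0 < a) (hθ : 0 < θ) (hσ : σ ≤ 1 / 2) (N : ℕ)
    (Φ : Flow σ N) (i : Fin (N + 1)) {S : Set V3} (hS : MeasurableSet S) :
    gibbs σ a θ N Φ {z | (z i).2 ∈ S} = gaussMeasure (0 : V3) θ S := by
  haveI hP : IsProbabilityMeasure
      (localGibbsMeasure σ (fun _ => a) (fun _ => (0 : V3)) (fun _ => θ) N) := by
    have h := isProbabilityMeasure_gibbs ha hθ hσ N Φ
    rwa [gibbs, localGibbsLaw_eq] at h
  rw [gibbs, localGibbsLaw_eq]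
  set w : (Fin (N + 1) → T3) → ℝ≥0∞ := fun x => ENNReal.ofReal
    ((canonicalPartition (Torus.geometry (Fin 3)) (hsDiameter σ N) (N + 1)
      (localGibbsProfile (fun _ => a) (fun _ => (0 : V3)) (fun _ => θ)))⁻¹ *
      posWeight (fun _ => a) (hsDiameter σ N) (N + 1) x) with hw
  have hwm : Measurable w :=
    (measurable_const.mul (measurable_posWeight (a₀ := fun _ => a) continuous_const _ _)).ennreal_ofReal
  have hdis : ∀ {G : Config (N + 1) (Fin 3) T3 → ℝ≥0∞}, Measurable G →
      ∫⁻ z, G z ∂localGibbsMeasure σ (fun _ => a) (fun _ => (0 : V3)) (fun _ => θ) N =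
        ∫⁻ x, w x * ∫⁻ v, G (zipConfig (x, v)) ∂velMeasure (fun _ => (0 : V3)) (fun _ => θ) x :=
    fun hG => lintegral_localGibbsMeasure (a₀ := fun _ => a) (θ₀ := fun _ => θ)
      (u₀ := fun _ => (0 : V3)) continuous_const continuous_const continuous_const
      (fun _ => ha.le) (fun _ => hθ) σ N hG
  have hE : MeasurableSet {z : Config (N + 1) (Fin 3) T3 | (z i).2 ∈ S} :=
    (measurable_pi_apply i).snd hS
  have hvel : ∀ x : Fin (N + 1) → T3,
      velMeasure (fun _ => (0 : V3)) (fun _ => θ) x {v | v i ∈ S} = gaussMeasure (0 : V3) θ S :=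
    fun x => (measurePreserving_eval (fun _ : Fin (N + 1) => gaussMeasure (0 : V3) θ) i).measure_preimage
      hS.nullMeasurableSet
  have h1 : localGibbsMeasure σ (fun _ => a) (fun _ => (0 : V3)) (fun _ => θ) N
      {z | (z i).2 ∈ S} = (∫⁻ x, w x) * gaussMeasure (0 : V3) θ S := by
    rw [← lintegral_indicator_one hE, hdis (measurable_one.indicator hE)]
    have hin : ∀ x : Fin (N + 1) → T3,
        ∫⁻ v, ({z : Config (N + 1) (Fin 3) T3 | (z i).2 ∈ S}).indicator
            (1 : Config (N + 1) (Fin 3) T3 → ℝ≥0∞) (zipConfig (x, v))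
          ∂velMeasure (fun _ => (0 : V3)) (fun _ => θ) x = gaussMeasure (0 : V3) θ S := by
      intro x
      have hfun : (fun v : Fin (N + 1) → V3 =>
          ({z : Config (N + 1) (Fin 3) T3 | (z i).2 ∈ S}).indicator
            (1 : Config (N + 1) (Fin 3) T3 → ℝ≥0∞) (zipConfig (x, v))) =
          ({v : Fin (N + 1) → V3 | v i ∈ S}).indicator 1 := by
        funext v
        by_cases hv : v i ∈ S
        · have hz : zipConfig (x, v) ∈ {z : Config (N + 1) (Fin 3) T3 | (z i).2 ∈ S} := by
            show (zipConfig (x, v) i).2 ∈ S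
            rw [zipConfig_apply]
            exact hv
          rw [Set.indicator_of_mem hz,
            Set.indicator_of_mem (show v ∈ {v : Fin (N + 1) → V3 | v i ∈ S} from hv)]
          rfl
        · have hz : zipConfig (x, v) ∉ {z : Config (N + 1) (Fin 3) T3 | (z i).2 ∈ S} := by
            show (zipConfig (x, v) i).2 ∉ S
            rw [zipConfig_apply]
            exact hv
          rw [Set.indicator_of_notMem hz,
            Set.indicator_of_notMem (show v ∉ {v : Fin (N + 1) → V3 | v i ∈ S} from hv)]
      have hSv : MeasurableSet {v : Fin (N + 1) → V3 | v i ∈ S} := (measurable_pi_apply i) hS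
      rw [hfun, lintegral_indicator_one hSv, hvel]
    simp_rw [hin]
    exact lintegral_mul_const _ hwm
  have h2 : localGibbsMeasure σ (fun _ => a) (fun _ => (0 : V3)) (fun _ => θ) N univ =
      ∫⁻ x, w x := by
    rw [← lintegral_one, hdis measurable_const]
    refine lintegral_congr fun x => ?_
    rw [lintegral_one, measure_univ, mul_one]
  rw [h1, ← h2, measure_univ, one_mul]

/-- A centred Gaussian on `ℝ³` charges every nonempty open set. -/
theorem gaussMeasure_pos_of_isOpen {θ : ℝ} (hθ : 0 < θ) {S : Set V3} (hS : IsOpen S)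
    (hne : S.Nonempty) : 0 < gaussMeasure (0 : V3) θ S := by
  rw [← withDensity_localMaxwellian_eq_gaussMeasure hθ (0 : V3), pos_iff_ne_zero, Ne,
    withDensity_apply_eq_zero'
      (continuous_localMaxwellian 1 θ (0 : V3)).measurable.ennreal_ofReal.aemeasurable]
  have hset : {v : V3 | ENNReal.ofReal (localMaxwellian 1 θ (0 : V3) v) ≠ 0} = univ :=
    eq_univ_of_forall fun v => (ENNReal.ofReal_pos.2 (localMaxwellian_pos one_pos hθ _ _)).ne'
  rw [hset, univ_inter]
  exact (hS.measure_pos volume hne).ne'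

end IdealGas

open IdealGas in
/-- ANY PROOF MUST USE `0 < σ` (collisions): the ideal gas breaks the `j = i` clause. Witness
`a = θ = 1`, `σ = -1` (free flight `idealGasFlow`), `t = 1/(8c)`, `δ = 1/8` (threshold `1/4`):
the sub-event `{1/4 < ‖t v₀‖ < 1/2}` has Gibbs probability `N(0, id){…} > 0` for EVERY `N`
(`gibbs_vel_apply`, `euclidDist_self_add_proj`). Unconditional; landed copy
`Theorems/GibbsLightCone/Negative/IdealGas.lean`. -/
theorem gibbsLightCone_false_without_posDiameter : ¬ GibbsLightConeWithoutPosDiameter := by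
  intro h
  obtain ⟨σ₀, hσ₀, c, hc, h⟩ := h 1 1 one_pos one_pos
  set Φ : (N : ℕ) → Flow (-1) N := fun N => idealGasFlow (hsDiameter_neg_one_neg N) (N + 1)
    with hΦ
  set t : ℝ := 1 / (8 * c) with ht
  have htpos : 0 < t := by positivity
  have hthr : c * t + 1 / 8 = 1 / 4 := by
    rw [ht]
    field_simp
    norm_num
  have key := h (-1) (by linarith) Φ t htpos.le (1 / 8) (by norm_num)
  set S : Set V3 := {w | 1 / 4 < ‖t • w‖ ∧ ‖t • w‖ < 1 / 2} with hSdef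
  have hSopen : IsOpen S :=
    isOpen_Ioo.preimage (continuous_id.const_smul t).norm
  have hSne : S.Nonempty := by
    obtain ⟨u, hu⟩ := exists_ne (0 : V3)
    have hun : 0 < ‖u‖ := norm_pos_iff.2 hu
    refine ⟨(3 / (8 * t * ‖u‖)) • u, ?_⟩
    have hnorm : ‖t • ((3 / (8 * t * ‖u‖)) • u)‖ = 3 / 8 := by
      rw [norm_smul, norm_smul, Real.norm_eq_abs, Real.norm_eq_abs, abs_of_pos htpos,
        abs_of_pos (by positivity)]
      field_simp
    refine ⟨?_, ?_⟩ <;> rw [hnorm] <;> norm_num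
  have hSmeas : MeasurableSet S := hSopen.measurableSet
  have hsub : ∀ N : ℕ, {z : Config (N + 1) (Fin 3) T3 | (z 0).2 ∈ S} ⊆
      cruxEvent (-1) N (Φ N) c t (1 / 8) := by
    intro N z hz
    refine ⟨0, 0, Or.inl rfl, ?_⟩
    show c * t + 1 / 8 < Torus.euclidDist (z 0).1 ((z 0).1 + Torus.proj (t • (z 0).2))
    rw [euclidDist_self_add_proj _ hz.2, hthr]
    exact hz.1
  have hpos : 0 < gaussMeasure (0 : V3) 1 S := gaussMeasure_pos_of_isOpen one_pos hSopen hSne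
  have hge : ∀ N : ℕ, gaussMeasure (0 : V3) 1 S ≤ gibbs (-1) 1 1 N (Φ N)
      (cruxEvent (-1) N (Φ N) c t (1 / 8)) := fun N =>
    (gibbs_vel_apply one_pos one_pos (by norm_num) N (Φ N) 0 hSmeas).symm.le.trans
      (measure_mono (hsub N))
  obtain ⟨N, hN⟩ := (key.eventually (gt_mem_nhds hpos)).exists
  exact absurd (hge N) (not_le.2 hN)

end Summit.AtomisticToContinuum.HydrodynamicLimit.Cruxes.GibbsLightCone.Disproof

end
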